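import Summits.ABC.IUTFork.Thm311RealArchHermitian
import HarnessLib

/-!
# [IUTchIII] Theorem 3.11 over real definitions — the archimedean comparison `⨂_ℚ ⊕_{w|∞} K_w → ⨂_ℝ ⊕_{w|∞} ℂ_w`
# is SURJECTIVE when every archimedean place is complex (print's `F ⊇ ℚ(√−1)`)

Proof-only file (D-0012) of the abc-iut cell (WAVE-5 prover seat abc-iut-w5-d043, gen 2; home layer L6; piece
(b) of the «ARCH-PACKET COMPARISON» offer of 2026-08-26T02:09Z, GO from abc-iut-w4-d001 02:21:45Z);
TAKES NO SIDE on [IUTchIII] Cor. 3.12. Nothing of another seat's file is restated or edited.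

abc-iut-w4-d001's `Thm311RealArchHermitian` defines, for abc-iut-c312-5's real signature `Real.logShells X logv …`
(`Thm311Real`), the archimedean comparison
`Real.archComparison j : 𝓘^ℚ(^{S^±_{j+1}};𝒟⊢_∞) = ⨂_ℚ^{i ≤ j} ⊕_{w|∞} K_w →ₗ[ℚ] ⨂_ℝ^{i ≤ j} ⊕_{w|∞} ℂ_w`
(`⊗_ℚ x ↦ ⊗_ℝ (archEmb ∘ x)`, componentwise Mathlib `extensionEmbedding`) and print's archimedean integral
structure `Real.archPkHermitian j` = the preimage of abc-iut-w4-d039's Hermitian unit ball `hermitianBallN`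
([IUTchIII] Prop. 3.2 (ii), kurims `paper:url-4b091feeb646` pp. 98–99).  THIS file proves:

* `Real.archEmb_surjective_of_isComplex` — at a COMPLEX place `K_w → ℂ` is onto (Mathlib
  `surjective_extensionEmbedding_of_isComplex`); hence `Real.archPacket1Map_surjective` when every `w | ∞`
  is complex;
* **`Real.archComparison_surjective`** — if every archimedean place of `F` is complex (print: [IUTchI]
  Def. 3.1 (a) "`F` is a number field such that `√−1 ∈ F`", so `F` is totally complex), then
  `archComparison j` is SURJECTIVE for every label `j`: its range is a `ℚ`-submodule containing every pure
  tensor `⊗_ℝ y` (componentwise surjectivity) and closed under real scaling (`r • ⊗_ℝ y = ⊗_ℝ (update y i₀ (r•y_{i₀}))`,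
  the index type `S^±_{j+1}` being inhabited), and pure tensors `ℝ`-span `⨂_ℝ` (`PiTensorProduct.induction_on`);
* `Real.image_archPkHermitian` — consequently the image of print's integral structure on the real packet IS the
  Hermitian ball: `archComparison j '' archPkHermitian j = hermitianBallN (S^±_{j+1}) {w|∞} π` — so any
  archimedean log-volume read downstairs (radial / Hermitian, [AbsTopIII] Prop. 5.7 (ii); [IUTchIV] Prop. 1.5
  (iii)) sees exactly print's ball, not a proper part of it.

WHY (neutral): abc-iut-w4-d001 `Thm311RealArchShell` / `Thm311RealArchHermitian` and abc-iut-c312-5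
`Cor312SettingDHVol` (archimedean factor index `PEmpty`) leave the cell's REAL instantiation with a trivial
archimedean container; a non-trivial one computes volumes DOWNSTAIRS in `⨂_ℝ ⊕ ℂ`, which is faithful only if the
comparison is onto (else hull-sets downstairs have preimages missing directions).  Surjectivity needs exactly
print's hypothesis; at a REAL place `w` the image of `K_w ≅ ℝ` is the real line and the range of the comparison
is the proper subspace `⨂_ℝ ⊕_w im(K_w)` (not proved here; recorded).  Classical linear algebra over landed
vocabulary; no `Prop` fact; no judgement. [claim: Mochizuki2012, status: disputed] for the quoted containers.
-/

noncomputable section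

namespace Summit.ABC.IUTFork.Thm311.Real

open NumberField Literature.IUT.LogVolume Literature.IUT.LogVolume.Prop15iii Literature.IUT.LogThetaLattice
open PiTensorProduct

variable {F : Type} [Field F] [NumberField F]
variable (X : PilotData F) (logv : PadicLogs F) (Aut Ism : ∀ x : Place F, Set (Carrier x ≃ₗ[ℚ] Carrier x))
  (hAut : ∀ x, LinearEquiv.refl ℚ (Carrier x) ∈ Aut x) (hIsm : ∀ x, LinearEquiv.refl ℚ (Carrier x) ∈ Ism x)

/-! ## 1. Componentwise surjectivity at complex places -/

/-- **At a complex archimedean place `K_w → ℂ` is onto** (Mathlib: the completion at a complex place is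
isometric to `ℂ`). [folklore] -/
theorem archEmb_surjective_of_isComplex (hF : ∀ w : InfinitePlace F, w.IsComplex) :
    ∀ w : ArchFibre X, Function.Surjective (archEmb X w)
  | ⟨.inl w, _⟩ => InfinitePlace.Completion.surjective_extensionEmbedding_of_isComplex (hF w)
  | ⟨.inr _, h⟩ => absurd h (by simp [thetaIndex])

/-- The 1-packet comparison `⊕_{w|∞} K_w → ⊕_{w|∞} ℂ_w` is onto when every `w | ∞` is complex. [folklore] -/
theorem archPacket1Map_surjective (hF : ∀ w : InfinitePlace F, w.IsComplex) :
    Function.Surjective (archPacket1Map X logv Aut Ism hAut hIsm) := by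
  intro y
  choose x hx using fun w => archEmb_surjective_of_isComplex X hF w (y w)
  exact ⟨x, funext fun w => by rw [archPacket1Map_apply, hx]⟩

/-! ## 2. Surjectivity of the tensor-packet comparison -/

/-- The range of the archimedean comparison contains every pure tensor `⊗_ℝ y` (componentwise surjectivity).
[folklore] -/
theorem tprod_mem_range_archComparison (hF : ∀ w : InfinitePlace F, w.IsComplex) (j : (thetaIndex X).Label)
    (y : (thetaIndex X).Caps j → M (ArchFibre X)) :
    PiTensorProduct.tprod ℝ y ∈ LinearMap.range (archComparison X logv Aut Ism hAut hIsm j) := by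
  choose x hx using fun i => archPacket1Map_surjective X logv Aut Ism hAut hIsm hF (y i)
  refine ⟨(logShells X logv Aut Ism hAut hIsm).tprod j _ x, ?_⟩
  rw [archComparison_tprod]
  exact congrArg (PiTensorProduct.tprod ℝ) (funext hx)

/-- **The archimedean comparison is SURJECTIVE when `F` is totally complex** (print: `√−1 ∈ F`, [IUTchI]
Def. 3.1 (a)): its range is a `ℚ`-submodule of `⨂_ℝ ⊕_{w|∞} ℂ_w` containing all pure tensors and — since
`r • ⊗_ℝ y` is again a pure tensor — every real multiple of them, hence everything. [folklore] -/
theorem archComparison_surjective (hF : ∀ w : InfinitePlace F, w.IsComplex) (j : (thetaIndex X).Label) :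
    Function.Surjective (archComparison X logv Aut Ism hAut hIsm j) := by
  intro t
  suffices h : t ∈ LinearMap.range (archComparison X logv Aut Ism hAut hIsm j) by
    obtain ⟨s, hs⟩ := h
    exact ⟨s, hs⟩
  induction t using PiTensorProduct.induction_on with
  | smul_tprod r y =>
    -- `r • ⊗ y = ⊗ (update y i₀ (r • y i₀))`, a pure tensor again (`S^±_{j+1}` is inhabited by `0`)
    haveI : Nonempty ((thetaIndex X).Caps j) := ⟨0⟩
    obtain ⟨i₀⟩ := (inferInstance : Nonempty ((thetaIndex X).Caps j))
    have hr : r • PiTensorProduct.tprod ℝ y = PiTensorProduct.tprod ℝ (Function.update y i₀ (r • y i₀)) := by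
      rw [MultilinearMap.map_update_smul, Function.update_eq_self]
    rw [hr]
    exact tprod_mem_range_archComparison X logv Aut Ism hAut hIsm hF j _
  | add a b ha hb => exact Submodule.add_mem _ ha hb

/-- Equivalently: the range of the comparison is everything. [folklore] -/
theorem range_archComparison_eq_top (hF : ∀ w : InfinitePlace F, w.IsComplex) (j : (thetaIndex X).Label) :
    LinearMap.range (archComparison X logv Aut Ism hAut hIsm j) = ⊤ :=
  LinearMap.range_eq_top.mpr (archComparison_surjective X logv Aut Ism hAut hIsm hF j)

/-! ## 3. The image of print's integral structure is the whole Hermitian ball -/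

/-- **The image of `𝓘(^{S^±_{j+1}}𝒟⊢_∞)` under the comparison IS the Hermitian unit ball** (totally complex `F`):
`archComparison '' archPkHermitian = hermitianBallN … π` — image of a preimage under a surjection. So a log-volume
read downstairs sees exactly print's ball. [claim: Mochizuki2012, status: disputed] -/
theorem image_archPkHermitian [Fintype (ArchFibre X)] (hF : ∀ w : InfinitePlace F, w.IsComplex)
    (j : (thetaIndex X).Label) :
    archComparison X logv Aut Ism hAut hIsm j '' archPkHermitian X logv Aut Ism hAut hIsm j =
      hermitianBallN ((thetaIndex X).Caps j) (ArchFibre X) Real.pi :=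
  Set.image_preimage_eq _ (archComparison_surjective X logv Aut Ism hAut hIsm hF j)

/-- In particular print's archimedean integral structure on the real packet is NONEMPTY (it contains `0`, whose
image `0` lies in the ball). [folklore] -/
theorem zero_mem_archPkHermitian [Fintype (ArchFibre X)] (j : (thetaIndex X).Label) :
    (0 : (logShells X logv Aut Ism hAut hIsm).Packet j (infty X)) ∈ archPkHermitian X logv Aut Ism hAut hIsm j := by
  rw [mem_archPkHermitian_iff, map_zero, mem_hermitianBallN_iff]
  simp only [map_zero]
  positivity

end Summit.ABC.IUTFork.Thm311.Real

end
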